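import Mathlib.AlgebraicGeometry.Morphisms.ClosedImmersion
import Mathlib.AlgebraicGeometry.Morphisms.Proper
import Literature.NumberTheory.Transcendental.ProjectiveSpace
import Literature.NumberTheory.Transcendental.Analytification
import Literature.Geometry.Kaehler.AnalyticSet
import Literature.Geometry.Kaehler.Kaehler
import Literature.AlgebraicGeometry.Motives.ChowTheorem
import HarnessLib

-- provenance: harness21/H21/H21/Statements/Hodge/GAGA.lean @ b6a64e5 (interim HEAD d8f2665); M5 mechanical rewrite
/-!
# Chow's theorem in projective form and GAGA-type statements (family `Hodge`, **hodge.S17**)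

Trunk: TranscendKaehlerL (Hodge / GAGA family), outline item G26 `GAGAStmt`.

Informal target (**hodge.S17**): *Chow's theorem and GAGA — closed analytic subvarieties of a
projective variety are algebraic; analytic and algebraic coherent sheaves and their cohomology
correspond.* [W.-L. Chow, *On compact complex analytic varieties*, Amer. J. Math. **71** (1949),
Thm. V; J.-P. Serre, *Géométrie algébrique et géométrie analytique* (GAGA), Ann. Inst. Fourier
**6** (1956), §2 Prop. 6, §3 Prop. 13 and Thms. 1–3; A. Grothendieck, M. Raynaud, *SGA 1*,
Exp. XII.]

## Contents

Throughout `V := Fin (n + 1) → ℂ = ℂⁿ⁺¹` and `ℙ ℂ V = ℙⁿ(ℂ)` carries the charted-space structure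
(standard affine atlas, model `Fin n → ℂ`) of `Literature.Prelude.TranscendKaehlerL.ProjectiveSpace`;
"analytic subset of `ℙⁿ`" is `Literature.IsAnalyticSet 𝓘(ℂ, Fin n → ℂ)`.

* **Bridge to the accepted cone form.** The accepted file `Literature.Statements.Hodge.ChowTheorem`
  states **hodge.S17** for closed cones `Z ⊆ ℂⁿ⁺¹` analytic off the vertex
  (`Literature.AlgebraicGeometry.Motives.exists_finset_isHomogeneous_of_isCone`). We relate the two settings through the
  affine cone `Projectivization.conePreimage Z = {0} ∪ π⁻¹(Z)`:
  `isProjAlgebraicSet_iff_isCone_preimage` (proved), `isCone_conePreimage` (proved),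
  `isClosed_conePreimage_iff` (proved), `isAnalyticSetOn_conePreimage_iff` (elementary,
  deferred) and `isAnalyticSet_conePreimage_iff` (whose hard direction *at the vertex* is the
  Remmert–Stein theorem, i.e. Chow's theorem itself; deferred and unused below).
* **Projective form of Chow's theorem.** `Literature.AlgebraicGeometry.Motives.isProjAlgebraicSet_of_isAnalyticSet` (a
  closed analytic subset of `ℙⁿ(ℂ)` is `Literature.NumberTheory.Transcendental.IsProjAlgebraicSet`, the common zero locus of
  finitely many homogeneous polynomials) is a *named fact* (`def … : Prop`, statement only).
  The theorem `isProjAlgebraicSet_of_isAnalyticSet_of_cone_form` derives that statement, by a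
  genuine proof from the three elementary bridge lemmas, from the named facts
  `Literature.AlgebraicGeometry.Motives.exists_finset_isHomogeneous_of_isCone` (the cone form, `ChowTheorem.lean`) and
  `isAnalyticSetOn_conePreimage_iff` (the analytic bridge), taken as hypotheses — so that the two
  **hodge.S17** files are visibly one theorem. Corollary for closed analytic subsets of a
  projective algebraic set (the inventory wording "subvarieties of a projective variety";
  hypothesis: the fact `isProjAlgebraicSet_of_isAnalyticSet`), and the converse fact
  `Literature.NumberTheory.Transcendental.IsProjAlgebraicSet.isAnalyticSet` (closedness is already the theorem
  `Literature.NumberTheory.Transcendental.IsProjAlgebraicSet.isClosed` in `ProjectiveSpace.lean`).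
* **GAGA-flavoured analytification statements** (supporting material, not tagged)
  [Serre GAGA §2 Prop. 6; SGA1 XII]: existence of `X^an` for smooth separated `X / k`, `k ⊆ ℂ`,
  and compactness of `X^an` for proper `X` are the upstream named facts
  `Literature.NumberTheory.Transcendental.exists_isAnalytification` and `Literature.NumberTheory.Transcendental.IsAnalytification.compactSpace`
  (`Analytification.lean`; not restated here);
  `isKaehlerManifold_of_isAnalytification_of_isClosedImmersion` (smooth projective ⇒ `X^an`
  Kähler, by restricting the Fubini–Study metric) and `isKaehlerManifold_projectivization`
  (`ℙⁿ(ℂ)` is Kähler: Fubini–Study) are named facts of this file.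

## What is not stated

Serre's Theorems 1–3 (equivalence of algebraic and analytic coherent sheaves on a projective
variety and comparison of their cohomology) need coherent analytic sheaves and their cohomology:
inventory notion `coherent_sheaf_gaga`, trunk T-MOTIVE, blocked. G21's `ChowTheorem.lean` states
the cone form; this file the projective form.

## Mathlib

Used as is: `Projectivization` (no topology/charts in Mathlib; those come from
`ProjectiveSpace.lean`), `MvPolynomial.IsHomogeneous`, `MvPolynomial.IsHomogeneous.totalDegree`,
`AlgebraicGeometry.IsClosedImmersion`,
`AlgebraicGeometry.SmoothOfRelativeDimension`. Schemes over `k` and `ℙᴺ_k` are the accepted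
`Literature.SchemeOver k = Over (Spec k)` and `Literature.projectiveSpace N k`
(`Literature.Prelude.MotiveAbstract.Varieties`), as consumed by `Literature.NumberTheory.Transcendental.IsAnalytification`. Mathlib has no
Chow theorem, analytification, or Kähler manifolds (searched `Chow`, `analytification`,
`Kaehler`, `FubiniStudy`); `isHomogeneous_totalDegree_of_exists` has no Mathlib counterpart
(searched `Homogeneous.lean`: closest are `IsHomogeneous.totalDegree`,
`totalDegree_zero_iff_isHomogeneous`).

## Design

* Everything lives in `namespace Literature.Hodge`, except the converse fact
  `Literature.NumberTheory.Transcendental.IsProjAlgebraicSet.isAnalyticSet`, declared with `_root_` next to the theorem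
  `Literature.NumberTheory.Transcendental.IsProjAlgebraicSet.isClosed` (naming pattern of the facts `IsAnalyticSet.union`,
  `IsAnalytification.compactSpace`; being a `Prop`-valued `def` it is not usable by dot notation —
  consumers take it as a hypothesis and apply it explicitly).
* The derivation goes through the *elementary* bridge `isAnalyticSetOn_conePreimage_iff`
  (analyticity of the cone off the vertex), not through `isAnalyticSet_conePreimage_iff`, so
  that no part of Chow's theorem is hidden in a bridge lemma. The bridge iffs carry no
  closedness hypothesis: each side implies that `Z` is closed.
* `isProjAlgebraicSet_of_isAnalyticSet` (a named fact) keeps the (redundant, cf.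
  `IsAnalyticSet.isClosed`) binder `IsClosed Z` prescribed by the outline, matching the informal
  wording "closed analytic subvariety"; in the derivation
  `isProjAlgebraicSet_of_isAnalyticSet_of_cone_form` that hypothesis is genuinely used.
* The analytification statements are stated for `X : Literature.SchemeOver k` over any subfield
  `k ⊆ ℂ` (`[Algebra k ℂ]`), the generality of `Literature.NumberTheory.Transcendental.IsAnalytification`; a closed `k`-immersion
  into `ℙᴺ_k` is a morphism `ι : X ⟶ Literature.projectiveSpace N k` in `Over (Spec k)` with
  `[IsClosedImmersion ι.left]`, the spelling of the accepted `Literature.AlgebraicGeometry.Motives.IsProjectiveOver`.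
* Instance-shaped facts on `ℙⁿ(ℂ)` with deferred proofs (`Literature.NumberTheory.Transcendental.isManifold_projectivization`, …)
  are named facts upstream; `isKaehlerManifold_projectivization` takes them as hypotheses and
  installs them with `haveI` inside its statement.
* M5 migration: results whose interim proofs were deferred are named facts (`def … : Prop`);
  the derived theorems (`isProjAlgebraicSet_of_isAnalyticSet_of_cone_form`,
  `isProjAlgebraicSet_of_isAnalyticSet_of_subset`, `isProjAlgebraicSet_iff_isAnalyticSet`) take
  the facts they use as explicit hypotheses.
-/

noncomputable section

open scoped Manifold ContDiff Topology LinearAlgebra.Projectivization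
open Set Projectivization AlgebraicGeometry CategoryTheory

namespace Literature.AlgebraicGeometry.Motives

section Hodge

/-! ### Bridge between projective sets and affine cones -/

section Bridge

variable {n : ℕ}

/-- A polynomial which is homogeneous of some degree is homogeneous of degree its total degree.
(Elementary; combines Mathlib's `IsHomogeneous.totalDegree` and `isHomogeneous_zero`.) [folklore] -/
theorem isHomogeneous_totalDegree_of_exists {σ R : Type*} [CommSemiring R]
    {F : MvPolynomial σ R} (hF : ∃ d, F.IsHomogeneous d) : F.IsHomogeneous F.totalDegree := by
  obtain ⟨d, hd⟩ := hF
  by_cases h0 : F = 0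
  · subst h0
    exact MvPolynomial.isHomogeneous_zero _ _ _
  · rwa [hd.totalDegree h0]

/-- The affine cone `C(Z) = {0} ∪ π⁻¹(Z) ⊆ ℂⁿ⁺¹` over any subset `Z ⊆ ℙⁿ(ℂ)` is a cone in the
sense of `Literature.AlgebraicGeometry.Motives.IsCone`. [Mumford, *Complex Projective Varieties* §4B] [folklore] -/
theorem isCone_conePreimage (Z : Set (ℙ ℂ (Fin (n + 1) → ℂ))) :
    IsCone (conePreimage Z : Set (Fin (n + 1) → ℂ)) :=
  fun c _ hz ↦ smul_mem_conePreimage c hz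

/-- The affine cone over the empty subset of `ℙ(W)` is the vertex `{0}`. [Mumford, *Complex
Projective Varieties* §2A] [folklore] -/
@[simp]
theorem conePreimage_empty {𝕜 W : Type*} [Field 𝕜] [AddCommGroup W] [Module 𝕜 W] :
    conePreimage (∅ : Set (ℙ 𝕜 W)) = {0} := by
  simp [conePreimage]

/-- The vertex `{0} ⊆ ℂⁿ⁺¹` is the common zero set of the coordinates `x₀, …, xₙ`. [folklore] -/
theorem singleton_zero_eq_setOf_forall_eval_X :
    ({0} : Set (Fin (n + 1) → ℂ)) =
      {v | ∀ F ∈ (Finset.univ.image MvPolynomial.X : Finset (MvPolynomial (Fin (n + 1)) ℂ)),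
        MvPolynomial.eval v F = 0} := by
  ext v
  simp only [mem_singleton_iff, Finset.mem_image, Finset.mem_univ, true_and,
    forall_exists_index, forall_apply_eq_imp_iff, MvPolynomial.eval_X, mem_setOf_eq]
  exact funext_iff

/-- **Bridge, algebraic part.** `Z ⊆ ℙⁿ(ℂ)` is projective algebraic iff its affine cone
`C(Z) ⊆ ℂⁿ⁺¹` is the common zero set of finitely many homogeneous polynomials. (For nonempty
`Z = V(S)` this is `conePreimage_projZeroLocus_of_nonempty`; for `Z = ∅` take the coordinates
`x₀, …, xₙ`.) [Mumford, *Complex Projective Varieties* §§2A, 4B; Griffiths–Harris p. 167] [folklore] -/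
theorem isProjAlgebraicSet_iff_isCone_preimage {Z : Set (ℙ ℂ (Fin (n + 1) → ℂ))} :
    Literature.NumberTheory.Transcendental.IsProjAlgebraicSet Z ↔ ∃ S : Finset (MvPolynomial (Fin (n + 1)) ℂ),
      (∀ F ∈ S, F.IsHomogeneous F.totalDegree) ∧
        conePreimage Z = {v | ∀ F ∈ S, MvPolynomial.eval v F = 0} := by
  constructor
  · rintro ⟨S, hS, rfl⟩
    rcases (projZeroLocus (↑S : Set (MvPolynomial (Fin (n + 1)) ℂ))).eq_empty_or_nonempty with
      h | h
    · refine ⟨Finset.univ.image MvPolynomial.X, fun F hF ↦ ?_, ?_⟩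
      · obtain ⟨i, -, rfl⟩ := Finset.mem_image.1 hF
        rw [MvPolynomial.totalDegree_X]
        exact MvPolynomial.isHomogeneous_X ℂ i
      · rw [h, conePreimage_empty, singleton_zero_eq_setOf_forall_eval_X]
    · exact ⟨S, hS, conePreimage_projZeroLocus_of_nonempty hS h⟩
  · rintro ⟨S, hS, hZ⟩
    refine ⟨S, hS, ?_⟩
    ext p
    induction p with
    | h v hv =>
      rw [mem_projZeroLocus_mk_iff hS, ← mem_conePreimage_iff hv, hZ, mem_setOf_eq]
      simp only [Finset.mem_coe]

/-- **Bridge, topological part.** The affine cone `C(Z)` is closed in `ℂⁿ⁺¹` iff `Z` is closed in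
`ℙⁿ(ℂ)` (the projection `ℂⁿ⁺¹ ∖ {0} → ℙⁿ` is a quotient map, and a closed subset of
`ℂⁿ⁺¹ ∖ {0}` stable under `ℂˣ` has closure meeting `{0}` at most). [Mumford, *Complex
Projective Varieties* §4B] [folklore] -/
theorem isClosed_conePreimage_iff {Z : Set (ℙ ℂ (Fin (n + 1) → ℂ))} :
    IsClosed (conePreimage Z : Set (Fin (n + 1) → ℂ)) ↔ IsClosed Z := by
  set π : {v : Fin (n + 1) → ℂ // v ≠ 0} → ℙ ℂ (Fin (n + 1) → ℂ) :=
    fun v ↦ Projectivization.mk ℂ v.1 v.2 with hπ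
  have hpre : π ⁻¹' Z = Subtype.val ⁻¹' conePreimage Z := by
    ext v
    simp [hπ, mem_conePreimage_iff v.2]
  constructor
  · intro h
    rw [← (isQuotientMap_mk (𝕜 := ℂ) (W := Fin (n + 1) → ℂ)).isClosed_preimage]
    change IsClosed (π ⁻¹' Z)
    rw [hpre]
    exact h.preimage continuous_subtype_val
  · intro h
    have hP : IsOpen (π ⁻¹' Z)ᶜ := (h.preimage continuous_mk).isOpen_compl
    have hs : IsOpen {v : Fin (n + 1) → ℂ | v ≠ 0} := isOpen_ne
    have himg : IsOpen (Subtype.val '' (π ⁻¹' Z)ᶜ) := hs.isOpenMap_subtype_val _ hP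
    rw [← isOpen_compl_iff]
    convert himg using 1
    ext v
    simp only [mem_compl_iff, mem_image, mem_preimage, hπ, Subtype.exists, exists_and_right,
      exists_eq_right]
    constructor
    · intro hv
      have hv0 : v ≠ 0 := fun h0 ↦ hv (h0 ▸ zero_mem_conePreimage Z)
      exact ⟨hv0, fun hZ ↦ hv ((mem_conePreimage_iff hv0).2 hZ)⟩
    · rintro ⟨hv0, hZ⟩ hv
      exact hZ ((mem_conePreimage_iff hv0).1 hv)

/-- **Bridge, analytic part (elementary).** The affine cone `C(Z)` is analytic near every point
of `ℂⁿ⁺¹ ∖ {0}` iff `Z` is an analytic subset of `ℙⁿ(ℂ)`: over the chart `Uᵢ = {zᵢ ≠ 0}` the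
projection is the holomorphic submersion `z ↦ (z_j / z_i)_{j ≠ i}` with holomorphic section
`w ↦ (w, 1)`, and local equations transport both ways. No closedness hypothesis is needed: either
side forces `Z` to be closed (`IsAnalyticSet.isClosed`, resp. relative closedness of
`C(Z) ∖ {0}` in `ℂⁿ⁺¹ ∖ {0}` and `isQuotientMap_mk`). [Griffiths–Harris p. 167; Mumford,
*Complex Projective Varieties* §4B; Chirka §7.1] A named fact (statement only). [cite: GriffithsHarris1978, p. 167] -/
def isAnalyticSetOn_conePreimage_iff : Prop :=
  ∀ (Z : Set (ℙ ℂ (Fin (n + 1) → ℂ))),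
    Literature.Geometry.Kaehler.IsAnalyticSetOn 𝓘(ℂ, Fin (n + 1) → ℂ) (conePreimage Z : Set (Fin (n + 1) → ℂ)) {0}ᶜ ↔
      Literature.Geometry.Kaehler.IsAnalyticSet 𝓘(ℂ, Fin n → ℂ) Z

/-- **Bridge, analytic part (at the vertex).** The affine cone `C(Z)` is an analytic subset of
all of `ℂⁿ⁺¹` iff `Z` is an analytic subset of `ℙⁿ(ℂ)`. The direction `→` and analyticity of
`C(Z)` *off the vertex* are elementary (`isAnalyticSetOn_conePreimage_iff`); analyticity of
`C(Z)` **at the vertex `0`** is the Remmert–Stein extension theorem across a point, i.e.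
precisely the content of Chow's theorem — this lemma is therefore not elementary and is *not*
used in the derivation `isProjAlgebraicSet_of_isAnalyticSet_of_cone_form`.
[Griffiths–Harris p. 167; Mumford, *Complex Projective Varieties* §4B; Chirka §7.1] A named
fact (statement only). [cite: GriffithsHarris1978, p. 167] -/
def isAnalyticSet_conePreimage_iff : Prop :=
  ∀ (Z : Set (ℙ ℂ (Fin (n + 1) → ℂ))),
    Literature.Geometry.Kaehler.IsAnalyticSet 𝓘(ℂ, Fin (n + 1) → ℂ) (conePreimage Z : Set (Fin (n + 1) → ℂ)) ↔
      Literature.Geometry.Kaehler.IsAnalyticSet 𝓘(ℂ, Fin n → ℂ) Z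

end Bridge

/-! ### Chow's theorem, projective form -/

section Chow

variable {n : ℕ}

/-- **hodge.S17** (Chow's theorem: the cone form implies the projective form; Chow, Amer. J.
Math. 71 (1949), Thm. V; Serre, GAGA (1956), §3 Prop. 13; cone reformulation: Griffiths–Harris
p. 167, Mumford, *Complex Projective Varieties* §4B). Assume the cone form of Chow's theorem in
dimension `n + 1` — the *statement* of the accepted `Literature.AlgebraicGeometry.Motives.exists_finset_isHomogeneous_of_isCone`:
every closed cone in `ℂⁿ⁺¹` analytic off the vertex is cut out by finitely many homogeneous
polynomials (the named fact `Literature.AlgebraicGeometry.Motives.exists_finset_isHomogeneous_of_isCone` itself, hypothesis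
`cone_form`) — and the elementary analytic bridge `isAnalyticSetOn_conePreimage_iff` (a named
fact, hypothesis `bridge`). Then every closed analytic subset `Z ⊆ ℙⁿ(ℂ)` is projective
algebraic, i.e. the statement of the fact `isProjAlgebraicSet_of_isAnalyticSet` holds. The proof
is the bridge: `C(Z)` is a closed cone, analytic off the vertex, hence cut out by homogeneous
polynomials, hence `Z` is their projective zero locus. [cite: GAGA1956, §3 Prop. 13] -/
theorem isProjAlgebraicSet_of_isAnalyticSet_of_cone_form
    (bridge : isAnalyticSetOn_conePreimage_iff (n := n))
    (cone_form : exists_finset_isHomogeneous_of_isCone (n := n))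
    {Z : Set (ℙ ℂ (Fin (n + 1) → ℂ))} (hZc : IsClosed Z) (hZ : Literature.Geometry.Kaehler.IsAnalyticSet 𝓘(ℂ, Fin n → ℂ) Z) :
    Literature.NumberTheory.Transcendental.IsProjAlgebraicSet Z := by
  obtain ⟨S, hS, hSZ⟩ := cone_form (isClosed_conePreimage_iff.2 hZc) (isCone_conePreimage Z)
    ((bridge Z).2 hZ)
  exact isProjAlgebraicSet_iff_isCone_preimage.2
    ⟨S, fun F hF ↦ isHomogeneous_totalDegree_of_exists (hS F hF), hSZ⟩

/-- **hodge.S17** (Chow's theorem, projective form; Chow, Amer. J. Math. 71 (1949), Thm. V;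
Serre, GAGA (1956), §3 Prop. 13; Griffiths–Harris p. 167; Mumford, *Complex Projective
Varieties* §4B). Every closed complex-analytic subset `Z` of projective space `ℙⁿ(ℂ)` is a
projective algebraic set: the common zero locus of finitely many homogeneous polynomials.
A named fact (statement only); it follows from the cone form
`Literature.AlgebraicGeometry.Motives.exists_finset_isHomogeneous_of_isCone` and the bridge
`isAnalyticSetOn_conePreimage_iff` (both named facts) by the theorem
`isProjAlgebraicSet_of_isAnalyticSet_of_cone_form`. (Closedness is part of `IsAnalyticSet`,
cf. `IsAnalyticSet.isClosed`; the hypothesis is kept to match the informal wording "closed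
analytic subvariety".) [cite: GAGA1956, §3 Prop. 13] -/
def isProjAlgebraicSet_of_isAnalyticSet : Prop :=
  ∀ {Z : Set (ℙ ℂ (Fin (n + 1) → ℂ))}, IsClosed Z → Literature.Geometry.Kaehler.IsAnalyticSet 𝓘(ℂ, Fin n → ℂ) Z →
    Literature.NumberTheory.Transcendental.IsProjAlgebraicSet Z

/-- **hodge.S17** (Chow's theorem for subvarieties of a projective variety; Chow 1949 Thm. V;
Serre, GAGA (1956), §3 Prop. 13). Let `X ⊆ ℙⁿ(ℂ)` be a projective algebraic set and `Z ⊆ X` a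
closed subset which is analytic near every point of `X`. Then `Z` is again a projective algebraic
set. Derived from Chow's theorem `isProjAlgebraicSet_of_isAnalyticSet` (a named fact,
hypothesis `hChow`); the hypothesis `_hX` only fixes the informal context (a closed subset of `ℙⁿ`
analytic near each of its points is analytic in `ℙⁿ`, whatever `X` is). [cite: Chow1949, Thm. V] -/
theorem isProjAlgebraicSet_of_isAnalyticSet_of_subset
    (hChow : isProjAlgebraicSet_of_isAnalyticSet (n := n)) {X Z : Set (ℙ ℂ (Fin (n + 1) → ℂ))}
    (_hX : Literature.NumberTheory.Transcendental.IsProjAlgebraicSet X) (hZX : Z ⊆ X) (hZc : IsClosed Z)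
    (hZ : Literature.Geometry.Kaehler.IsAnalyticSetOn 𝓘(ℂ, Fin n → ℂ) Z X) : Literature.NumberTheory.Transcendental.IsProjAlgebraicSet Z :=
  hChow hZc (Literature.Geometry.Kaehler.isAnalyticSet_iff_isClosed_and.2 ⟨hZc, hZ.mono hZX⟩)

/-- Converse to Chow's theorem (elementary): a projective algebraic set is an analytic subset of
`ℙⁿ(ℂ)` — in the affine chart `Uᵢ` the homogeneous equations `F = 0` become the polynomial (hence
holomorphic) equations `F(w₀, …, 1, …, w_{n-1}) = 0`. Declared in the namespace of
`Literature.NumberTheory.Transcendental.IsProjAlgebraicSet` (next to the theorem `Literature.NumberTheory.Transcendental.IsProjAlgebraicSet.isClosed`); as a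
`Prop`-valued `def` it is applied explicitly (`hconv h`), not by dot notation.
[Griffiths–Harris p. 166; Mumford, *Complex Projective Varieties* §4B] A named fact (statement
only). [cite: GriffithsHarris1978, p. 166] -/
def _root_.Literature.NumberTheory.Transcendental.IsProjAlgebraicSet.isAnalyticSet : Prop :=
  ∀ {Z : Set (ℙ ℂ (Fin (n + 1) → ℂ))}, Literature.NumberTheory.Transcendental.IsProjAlgebraicSet Z → Literature.Geometry.Kaehler.IsAnalyticSet 𝓘(ℂ, Fin n → ℂ) Z

/-- A subset of `ℙⁿ(ℂ)` is projective algebraic iff it is a (closed) analytic subset: Chow's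
theorem together with its elementary converse (from the named facts
`isProjAlgebraicSet_of_isAnalyticSet` and `IsProjAlgebraicSet.isAnalyticSet`). [Serre, GAGA
(1956), §3 Prop. 13; Griffiths–Harris p. 167] [cite: GAGA1956, §3 Prop. 13] -/
theorem isProjAlgebraicSet_iff_isAnalyticSet (hChow : isProjAlgebraicSet_of_isAnalyticSet (n := n))
    (hconv : Literature.NumberTheory.Transcendental.IsProjAlgebraicSet.isAnalyticSet (n := n)) {Z : Set (ℙ ℂ (Fin (n + 1) → ℂ))} :
    Literature.NumberTheory.Transcendental.IsProjAlgebraicSet Z ↔ Literature.Geometry.Kaehler.IsAnalyticSet 𝓘(ℂ, Fin n → ℂ) Z :=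
  ⟨fun h ↦ hconv h, fun h ↦ hChow h.isClosed h⟩

end Chow

/-! ### GAGA-type statements on analytifications -/

section GAGA

variable {k : Type} [Field k] [Algebra k ℂ] {X : SchemeOver k}

/-
M5 migration note: the interim restatements `compactSpace_of_isAnalytification_of_isProper` and
`exists_isAnalytification_schemeOver` were duplicates of the upstream named facts
`Literature.NumberTheory.Transcendental.IsAnalytification.compactSpace` and `Literature.NumberTheory.Transcendental.exists_isAnalytification`
(`Literature.NumberTheory.Transcendental.Analytification`) and have been removed in favour of
those survivors.
-/

variable {d : ℕ} {E : Type*} [NormedAddCommGroup E] [NormedSpace ℂ E] [FiniteDimensional ℂ E]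
  {M : Type*} [TopologicalSpace M] [ChartedSpace E M] {φ : M → ComplexPoints X}

/-- Smooth projective varieties are Kähler (supports hodge.S17; Serre, GAGA (1956), §2;
Griffiths–Harris pp. 31, 109; Voisin I, §3.1.3, Ex. 3.10 (Fubini–Study) and Prop. 3.1.10). Let
`X` be a smooth `k`-scheme (`k ⊆ ℂ`) of relative dimension `d` admitting a closed `k`-immersion
`ι : X ⟶ ℙᴺ_k` (a morphism in `Over (Spec k)`, so automatically over `Spec k`). Then any
analytification `M` of `X` carrying a holomorphic atlas is a Kähler manifold (restrict the
Fubini–Study metric of `ℙᴺ(ℂ)` along the induced closed holomorphic embedding `M ↪ ℙᴺ(ℂ)`).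
The `IsManifold` hypotheses on `M` are those required by `IsKaehlerManifold`. [cite: GAGA1956] -/
def isKaehlerManifold_of_isAnalytification_of_isClosedImmersion : Prop :=
  ∀ [IsManifold 𝓘(ℂ, E) ω M] [IsManifold 𝓘(ℝ, E) ∞ M] [SmoothOfRelativeDimension d X.hom] {N : ℕ} (ι : X ⟶ projectiveSpace N k) [IsClosedImmersion ι.left], Literature.NumberTheory.Transcendental.IsAnalytification E X d φ →
    Literature.Geometry.Kaehler.IsKaehlerManifold E M

/-- `ℙⁿ(ℂ)` is a Kähler manifold (supports hodge.S17): the Fubini–Study metric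
`ω_FS = (i / 2π) ∂∂̄ log ‖z‖²` [Griffiths–Harris pp. 30–31, 109; Voisin I, Ex. 3.10]. With the
standard atlas of `Literature.Prelude.TranscendKaehlerL.ProjectiveSpace` (whose manifold structure
theorems `Literature.NumberTheory.Transcendental.isManifold_projectivization` and `Literature.Geometry.Kaehler.isManifold_real_of_isManifold_complex` are
installed with `haveI`; the former is a named fact and enters as the hypothesis `h`), complex
projective space admits a smooth Kähler metric. A named fact (statement only). [cite: GriffithsHarris1978, pp. 30–31] -/
def isKaehlerManifold_projectivization : Prop :=
  ∀ (n : ℕ) (h : Literature.NumberTheory.Transcendental.isManifold_projectivization ℂ n),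
    haveI : IsManifold 𝓘(ℂ, Fin n → ℂ) ω (ℙ ℂ (Fin (n + 1) → ℂ)) := h
    haveI := Literature.Geometry.Kaehler.isManifold_real_of_isManifold_complex (E := Fin n → ℂ) (M := ℙ ℂ (Fin (n + 1) → ℂ))
    Literature.Geometry.Kaehler.IsKaehlerManifold (Fin n → ℂ) (ℙ ℂ (Fin (n + 1) → ℂ))

end GAGA

end Hodge

end Literature.AlgebraicGeometry.Motives
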